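import Summits.BirchSwinnertonDyer.BirchSwinnertonDyer.Theses.TwistFamilyManinDescent
import HarnessLib

/-!
# Route `TwistFamilyManinDescent`, LINE 17 (bsd-idea-3 g7), glue G17 `CornerResidualOfSupersingularTransport`
# (stmt-BirchSwinnertonDyer-27553) — PROVED BY NAME (row dispatch; the planner's `Sketch17.lean` argument)

Cell `pub/bsd-wall`, D-0145 line `route-BirchSwinnertonDyer-TeichmullerTwistDescent`, seat `bsd-line-ttd-p1` g9,
working the planner-of-record's TFMD LINE 17. BSD is NOT proved by this; Manin's conjecture is not proved by this;
the transported item T17 (`SupersingularCornerTwistTransport`, stmt-27551), the declared residual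
`OrdinaryCornerManinResidual` (stmt-27552), K15a (stmt-27072) and Ray57 (stmt-26325) all stay OPEN. This file closes
ONLY the propositional glue.

## Statement (verbatim the route decl)

`SupersingularCornerTwistTransport → OrdinaryCornerManinResidual → SupersingularStrongIsUnstarred →
EisensteinRaynaudRegimeManinUnit → EisensteinCornerManinResidual`.

## Proof

Row dispatch on the supersingular corner row `p = 5 ∧ v₅ Δ_min ∈ {2, 10}`: on it, T17 (fed K15a and Ray57);
off it, the ordinary-corner residual, whose binders are those of `EisensteinCornerManinResidual` plus exactly the
negation of that row. Design: theorems only; no definition, no named fact, no `sorry`; axioms `propext`,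
`Classical.choice`, `Quot.sound`.
-/

set_option autoImplicit false
-- the Theorems directory repeats the summit name (sibling precedent `TwistFamilyManinDescentStrongIsUnstarredOfKummerFree.lean`)
set_option linter.dupNamespace false

namespace Summit.BirchSwinnertonDyer.BirchSwinnertonDyer.Theorems.TwistFamilyManinDescent

open Summit.BirchSwinnertonDyer.BirchSwinnertonDyer.Theses.TwistFamilyManinDescent

/-- **Glue G17** (stmt-BirchSwinnertonDyer-27553), by name: the corner residual `EisensteinCornerManinResidual`
from the supersingular-corner twist transport T17, the ordinary-corner residual, K15a and Ray57 — row dispatch on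
`p = 5 ∧ v₅ Δ_min ∈ {2, 10}` (the planner's `Sketch17.cornerResidualOfSupersingularTransport_proof`). -/
theorem cornerResidualOfSupersingularTransport_proof : CornerResidualOfSupersingularTransport := by
  intro hT hO hK hR hM hAU hC hnf W _ _ N _ D p hp h57 hRay hN hirr hadd hopt
  by_cases hss : (p = 5 ∧ padicValInt 5 W.minimalDiscriminantInt ∈ ({2, 10} : Finset ℕ))
  · exact hT hK hR hM hAU hC hnf W D p hp hss hN hirr hadd hopt
  · exact hO hM hAU hC hnf W D p hp h57 hRay hss hN hirr hadd hopt

end Summit.BirchSwinnertonDyer.BirchSwinnertonDyer.Theorems.TwistFamilyManinDescent
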